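import Mathlib
import Summits.ValiantsHypothesis.ValiantsHypothesis.Theorems.NewtonFramesNewtonTauWeakBlockConvexLagrange

/-!
# Crux `NewtonTauWeak` (stmt-ValiantsHypothesis-5904), line `slope-ladder`: the block-convexity CEILING is slope `1/2`

Capstone of the Lagrange mechanism (`…BlockConvexLagrange`: `2k-1` planar `O_k(n)`-sets with `n^k` points of their
Minkowski sum in convex position).  Here it is turned into statements about EVERY block count `r` and about every
possible witness of STUB 1 (`stub_blockConvexBound`) of `Cruxes/NewtonTauWeak/Lines/slope_ladder.lean`:

* `blockBound_mono` — a bound `#S ≤ C (N+2)^e` valid for all `(r+1)`-fold sums (`r ≥ 1`) is valid for all `r`-fold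
  sums (append the summand `{0}`);
* `blockBound_exponent_lt_all` — for every `r ≥ 1` and every `e < ⌈r/2⌉` there is NO `C` with `#S ≤ C (N+2)^e` for
  all convexly independent `S ⊆ P_1 + ⋯ + P_r`, `#P_i ≤ N`: i.e. **`M_r(N) ≥ c_r N^{⌈r/2⌉}` for every `r`** (odd `r`
  is `…BlockConvexLagrange.blockConvexBound_exponent_lt`, even `r` follows by monotonicity), superseding
  [KoiranPortierTavenasThomasse2015, Prop. 1] (`N^{r/3}`);
* `stub_witness_delta_le` — consequently ANY witness `(r, δ, C)` of `stub_blockConvexBound` has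
  `(2/3 - δ) r ≥ ⌈r/2⌉`, hence `δ ≤ 1/6` and the slope `2/3 - δ` that STUB 2 (`stub_blocking`, landed) extracts is
  `≥ 1/2`: the rungs `SlopeThird` / `SubLinear` of the line's ladder are unreachable by block convexity, and
  `SlopeHalf` at best in the limit.  (KPTT's stated ceiling for this method family was slope `1/3`.)

The stub itself — SOME `r` with exponent `< 2r/3` — remains OPEN (`⌈r/2⌉ < 2r/3` for all `r ≥ 4`).
Helper for the crux item (`--supports`); nothing here bears on `NewtonTauWeak` or `VP ≠ VNP`.
-/

set_option linter.dupNamespace false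

namespace Summit.ValiantsHypothesis.ValiantsHypothesis.Theorems.NewtonFramesNewtonTauWeak.BlockConvexCeiling

open scoped BigOperators Pointwise
open Summit.ValiantsHypothesis.ValiantsHypothesis.Theorems.NewtonFramesNewtonTauWeak.BlockConvexLagrange
  (blockConvexBound_exponent_lt)

noncomputable section

/-- **Monotonicity in the number of summands.**  If `#S ≤ C (N+2)^e` holds for all `(r+1)`-fold sums of `N`-sets
and `r ≥ 1`, it holds for all `r`-fold sums (append `P_{r+1} = {0}` when `N ≥ 1`; for `N = 0` everything is empty
and the hypothesis at the empty configuration gives `0 ≤ C·2^e`). [folklore] -/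
theorem blockBound_mono (r : ℕ) (hr : 1 ≤ r) (C e : ℝ)
    (H : ∀ (N : ℕ) (P : Fin (r + 1) → Finset (Fin 2 → ℝ)) (S : Finset (Fin 2 → ℝ)),
      (∀ i, (P i).card ≤ N) → S ⊆ ∑ i, P i →
        ConvexIndependent ℝ (Subtype.val : ↥(S : Set (Fin 2 → ℝ)) → (Fin 2 → ℝ)) →
          (S.card : ℝ) ≤ C * ((N : ℝ) + 2) ^ e) :
    ∀ (N : ℕ) (P : Fin r → Finset (Fin 2 → ℝ)) (S : Finset (Fin 2 → ℝ)),
      (∀ i, (P i).card ≤ N) → S ⊆ ∑ i, P i →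
        ConvexIndependent ℝ (Subtype.val : ↥(S : Set (Fin 2 → ℝ)) → (Fin 2 → ℝ)) →
          (S.card : ℝ) ≤ C * ((N : ℝ) + 2) ^ e := by
  classical
  intro N P S hP hS hci
  rcases Nat.eq_zero_or_pos N with hN | hN
  · -- N = 0
    subst hN
    have hPe : ∀ i, P i = ∅ := fun i => Finset.card_eq_zero.1 (Nat.le_zero.1 (hP i))
    have hempty : (∑ j, P j) = ∅ := by
      have i : Fin r := ⟨0, hr⟩
      rw [← Finset.sum_erase_add Finset.univ P (Finset.mem_univ i), hPe i, Finset.add_empty]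
    have hS0 : S = ∅ := Finset.subset_empty.1 (hempty ▸ hS)
    have h0 := H 0 (fun _ => ∅) ∅ (fun _ => by simp) (Finset.empty_subset _)
      (by
        rw [convexIndependent_set_iff_notMem_convexHull_sdiff]
        intro x hx
        simp at hx)
    rw [hS0]
    exact h0
  · -- N ≥ 1: append the summand {0}
    set P' : Fin (r + 1) → Finset (Fin 2 → ℝ) := Fin.snoc P {0} with hP'
    have hP'card : ∀ i, (P' i).card ≤ N := by
      intro i
      induction i using Fin.lastCases with
      | last => rw [hP', Fin.snoc_last, Finset.card_singleton]; exact hN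
      | cast j => rw [hP', Fin.snoc_castSucc]; exact hP j
    have hsum : ∑ i, P' i = ∑ i, P i := by
      rw [Fin.sum_univ_castSucc]
      simp only [hP', Fin.snoc_castSucc, Fin.snoc_last, Finset.singleton_zero, add_zero]
    exact H N P' S hP'card (hsum ▸ hS) hci

/-- **`M_r(N) ≥ c_r N^{⌈r/2⌉}` for every `r ≥ 1`:** there is no bound `#S ≤ C (N+2)^e` with `e < ⌈r/2⌉ = (r+1)/2`
(integer division) for convexly independent subsets of `r`-fold Minkowski sums of planar `N`-sets.  Odd `r = 2k-1`:
the Lagrange configuration (`blockConvexBound_exponent_lt`); even `r = 2k`: monotonicity down to `2k-1`. [this file] -/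
theorem blockBound_exponent_lt_all (r : ℕ) (hr : 1 ≤ r) (C e : ℝ) (he : e < (((r + 1) / 2 : ℕ) : ℝ)) :
    ¬ ∀ (N : ℕ) (P : Fin r → Finset (Fin 2 → ℝ)) (S : Finset (Fin 2 → ℝ)),
        (∀ i, (P i).card ≤ N) → S ⊆ ∑ i, P i →
          ConvexIndependent ℝ (Subtype.val : ↥(S : Set (Fin 2 → ℝ)) → (Fin 2 → ℝ)) →
            (S.card : ℝ) ≤ C * ((N : ℝ) + 2) ^ e := by
  intro H
  rcases Nat.even_or_odd r with ⟨k, hk⟩ | ⟨k, hk⟩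
  · -- r = k + k, k ≥ 1: go down to 2k - 1 summands
    have hk1 : 1 ≤ k := by omega
    have hr' : r = (2 * k - 1) + 1 := by omega
    have hq : (r + 1) / 2 = k := by omega
    rw [hq] at he
    rw [hr'] at H
    exact blockConvexBound_exponent_lt k hk1 C e he (blockBound_mono (2 * k - 1) (by omega) C e H)
  · -- r = 2k + 1 = 2(k+1) - 1
    have hr' : r = 2 * (k + 1) - 1 := by omega
    have hq : (r + 1) / 2 = k + 1 := by omega
    rw [hq] at he
    rw [hr'] at H
    exact blockConvexBound_exponent_lt (k + 1) (by omega) C e (by exact_mod_cast he) H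

/-- **Every witness of STUB 1 has `δ ≤ 1/6`; the block-convexity method certifies no slope below `1/2`.**
If `(r, δ, C)` with `r ≥ 2` satisfies the bound of `stub_blockConvexBound`, then `(2/3 - δ)·r ≥ ⌈r/2⌉ ≥ r/2`, so
`2/3 - δ ≥ 1/2`.  (STUB 2 turns such a witness into `SlopeBound (2/3 - min δ (1/3))`; this shows the resulting slope is
at least `1/2`: the typed rungs `SlopeThird` and `SubLinear` are out of reach of the method family.) [this file] -/
theorem stub_witness_delta_le (r : ℕ) (hr : 2 ≤ r) (δ C : ℝ)
    (H : ∀ (N : ℕ) (P : Fin r → Finset (Fin 2 → ℝ)) (S : Finset (Fin 2 → ℝ)),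
        (∀ i, (P i).card ≤ N) → S ⊆ ∑ i, P i →
          ConvexIndependent ℝ (Subtype.val : ↥(S : Set (Fin 2 → ℝ)) → (Fin 2 → ℝ)) →
            (S.card : ℝ) ≤ C * ((N : ℝ) + 2) ^ ((2 / 3 - δ) * (r : ℝ))) :
    (((r + 1) / 2 : ℕ) : ℝ) ≤ (2 / 3 - δ) * (r : ℝ) ∧ 1 / 2 ≤ 2 / 3 - δ ∧ δ ≤ 1 / 6 := by
  have h1 : (((r + 1) / 2 : ℕ) : ℝ) ≤ (2 / 3 - δ) * (r : ℝ) := by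
    by_contra hlt
    push Not at hlt
    exact blockBound_exponent_lt_all r (by omega) C _ hlt H
  have hhalf : (r : ℝ) / 2 ≤ (((r + 1) / 2 : ℕ) : ℝ) := by
    have : r ≤ 2 * ((r + 1) / 2) := by omega
    have : (r : ℝ) ≤ 2 * (((r + 1) / 2 : ℕ) : ℝ) := by exact_mod_cast this
    linarith
  have hrpos : (0 : ℝ) < r := by exact_mod_cast (by omega : 0 < r)
  have h2 : 1 / 2 ≤ 2 / 3 - δ := by
    have h3 : (r : ℝ) / 2 ≤ (2 / 3 - δ) * (r : ℝ) := hhalf.trans h1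
    by_contra hlt
    push Not at hlt
    nlinarith
  exact ⟨h1, h2, by linarith⟩

end

end Summit.ValiantsHypothesis.ValiantsHypothesis.Theorems.NewtonFramesNewtonTauWeak.BlockConvexCeiling
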